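import Literature.MathematicalPhysics.QuantumFieldTheory.Balaban1983to89.B6MultiLevelTorusOperator
import Literature.MathematicalPhysics.QuantumFieldTheory.Balaban1983to89.B6Eq238MultiLevelBox

/-!
# `Balaban1983to89.B6Eq238MultiLevelTorus` — [B6] (2.36)–(2.38) FOR THE GENUINE `k`-LEVEL OPERATOR `Δ′_a` ON THE
TORUS `T_η`: the multi-size cube cover `𝒟` of the torus, ONE TRANSLATION CHART PER CUBE (every cube term is the
box-lineage term `h_□G′(□)v_□` of a CENTRAL cube of the translated family, transported along the chart), the periodic
(1.118) partition `Σ_□ u_□v_□ = 1`, and `Δ′_aG′₀ = 1 − R` (2.38) on print's carrier — file T2 of the torus carrier of the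
multi-level parametrix (no existing module is touched; no fact is minted)

FRAMING (verbatim cell line):
statement-level skeleton of published theorems with citation tags; proofs where landed; nothing here is a claim about the Yang–Mills mass gap

Source under audit (cell pub-balaban / lit-balaban): T. Bałaban, *Propagators and renormalization transformations for
lattice gauge theories. II*, Commun. Math. Phys. **96** (1984) 223–250 [`Balaban1984PropagatorsII`, "B6"], p. 229 [PDF 7]
(2.36)–(2.39), p. 230 [PDF 8] (2.40)–(2.44) (held text `paper:balaban1984-cmp96-propagators-rt-ii`, p0007/p0008); T. Bałaban,
*Propagators … I*, Commun. Math. Phys. **95** (1984) 17–40 [`Balaban1984PropagatorsI`], (1.118) p. 36 (the partition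
«Σ_{j∈Z} h_j² = 1»).  Unit `lit-balaban-p21` (Phase-2 proof seat p21 gen 15), HOME `run/shared/lean/pub/lit-balaban/`, B6 fold
owner r03, referee ref-4.  Box sibling (consumed BY NAME, untouched): `B6Eq238MultiLevelBox` (p21 gen 10).

## WHAT IS PRINTED (p. 229, verbatim up to notation)

«We cover B^j(Λ_j) by a sum of cubes □ of the size 2ML^jη, each cube being a sum of 2^d big blocks with a center
y ∈ Λ_j … Taking these covers for all j from 0 to k we get a family 𝒟 of cubes □ of different sizes and such that
T_η = ⋃_{□∈𝒟} □. … They satisfy Σ_{□∈𝒟} h_□² = 1. (2.36) … G′₀ = Σ_□ h_□G′(□)h_□, (2.37) where G′(□) is an inverse of Δ′_a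
with some boundary conditions on the boundary of □, e.g. with Neumann boundary conditions as in [3]. Repeating the
calculations in the paper we get Δ′_aG′₀ = I − Σ_□ K(h_□)G′(□)h_□ = I − R, (2.38)».

## WHAT THIS FILE CERTIFIES (kernel-checked; setting of `B6MultiLevelTorusOperator`)

For a nested family `D : TDomains d ℓ M_h k P R` of domains OF THE TORUS `T_η` (fundamental box `Π_μ[0, N₀_μ)`,
`N₀_μ = (M·L^k)·P_μ`, `P_μ ≥ 4`), weights `a_{i+1} = aNext ℓ a_i c_i`, and the torus operator `Δ′_a = mlOpT` of file T1:
* §1 **THE CHART OF A TORUS CUBE**: the level-`j` cubes of the torus are labelled by the periodic centre labels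
  `q ∈ Π_μ[0, P_j,μ)`, `P_j = L^{k−j}P` (centres `M·L^j·q`, sides `2M·L^j`, NO cut cubes — the torus has no boundary); the
  cube `(j, q)` is read in the chart `svec` (the torus translation by `(M·L^k)·(⌊q/L^{k−j}⌋ − 2)`), where it is the box cube
  of the CENTRAL label `qc = q mod L^{k−j} + 2L^{k−j}` (`q_eq_qc_add`; `qc_bounds`: `2 ≤ qc ≤ P_j − 2`, two half-widths
  off every wall).
* §2 `interior_of_uFun_ne_zero`: the printed profile of a central cube vanishes on the wall sites of the fundamental box
  (so the seam of file T1 never meets a cube term).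
* §3 **THE COVER AND THE TRANSPORTED TERMS**: `σc` (chart equivalence), `Dc = (D.chart svec).toDomains` (the box family of
  the chart), `cubeSetT` (active torus cubes; activity read in the chart), `CubeDataT`/`cubeData_chart` (a torus cube IS a
  central box cube of its chart: the lineage's `CubeData`), the cut-offs `uT`/`vT` (`vT_eq`: `v_□ = u_□·1_{B^j(Λ_j)}`), the
  summands **`aT = σ(h_□G′(□)v_□)σ⁻¹`** and **`bT = σ(K(h_□)G′(□)v_□)σ⁻¹`** (reindexed `aX`/`bX` of `B6Eq238MultiLevelBox`
  — the cube propagators are LITERALLY the genuine two-level Neumann cube propagators of the lineage), **`gZeroT = G′₀`**,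
  **`rT = R`**, and **`mlOpT_mul_aT`**: `Δ′_a·(h_□G′(□)v_□) = h_□v_□ − K(h_□)G′(□)v_□` on the torus (the box identity
  `mlOp_mul_aX` of the chart through the chart identity `mlOpT_mul_reindex` of file T1).
* §4 **(2.36) ON THE TORUS**: the transported profile is the printed (1.118) profile of the relabelled lattice label
  `q + P_j·mz(z)` (`uT_eq`; `mz_unique`: a central cube lies inside one period; `Qmap_injOn`, `mem_image_Qmap`), hence
  `Σ_{q∈Π[0,P_j)} u_{(j,q)}(z)² = 1` (`sum_uT_sq`, the PERIODIC partition of unity from the lattice identity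
  `Σ_{q∈ℤ^{d+1}} h_q² = 1` of `B4PartitionUnity22`) and **`Σ_{□∈𝒟} u_□v_□ = 1`** (`sum_uv_eq_one_T`).
* §5 **(2.38) ON THE TORUS**: `eq238_multiLevelTorus` — `Δ′_a·G′₀ = 1 − R`.

## HONEST SCOPE

* As in file T1: levels `1 … k`, `Ω₁ = T_η` (print's admitted case), `A = 0`, `m² = 0`, torus side `(M·L^k)·P_μ` with
  `P_μ ≥ 4` (print's torus is astronomically larger than a cube; four top blocks per direction are what the charts need);
  the partition is the lineage's ASYMMETRIC one (`u_□ = h_□`, `v_□ = h_□·1_{B^j(Λ_j)}`, `Σu_□v_□ = 1` exact; print's symmetric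
  `h_□G′(□)h_□` needs an unprinted matching of the (1.118) families across levels — cell divergence D-b06.38/42); the cube
  propagators are the Neumann two-level inverses of the lineage («e.g. with Neumann boundary conditions»); `R ≥ 2L`.
* Nothing is inferred from the manuscript: every step is kernel-checked; the quoted sentences locate the statements.
-/

namespace Literature.MathematicalPhysics.QuantumFieldTheory.Balaban1983to89.B6Eq238MultiLevelTorus

open Finset Matrix
open Literature.MathematicalPhysics.QuantumFieldTheory.Balaban1983to89.B4ContourShift (supNorm abs_le_supNorm
  supNorm_nonneg)
open Literature.MathematicalPhysics.QuantumFieldTheory.Balaban1983to89.B4Reflection242 (boxDom mem_boxDom nbrs mem_nbrs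
  blk)
open Literature.MathematicalPhysics.QuantumFieldTheory.Balaban1983to89.B4TorusKernel.MultiPeriod (torusSupNorm translate
  translate_apply)
open Literature.MathematicalPhysics.QuantumFieldTheory.Balaban1983to89.B6Ineq243TwoLevelBox (aNext)
open Literature.MathematicalPhysics.QuantumFieldTheory.Balaban1983to89.B6Partition236TwoLevelBox (hq hq_add_mul
  abs_lt_of_hq_ne_zero ctrs mem_ctrs mem_ctrs_of_hq_ne_zero pos hq_nonneg)
open Literature.MathematicalPhysics.QuantumFieldTheory.Balaban1983to89.B6Eq238TwoLevelBox (res emb)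
open Literature.MathematicalPhysics.QuantumFieldTheory.Balaban1983to89.B6MultiLevelBoxOperator
open Literature.MathematicalPhysics.QuantumFieldTheory.Balaban1983to89.B6Eq238MultiLevelBox
open Literature.MathematicalPhysics.QuantumFieldTheory.Balaban1983to89.B6MultiLevelTorusOperator
open Literature.MathematicalPhysics.QuantumFieldTheory.Balaban1983to89.B4PartitionUnity22 (hCube sum_hCube_sq)

noncomputable section

variable {d : ℕ}

/-! ## §1 The chart of a torus cube: top-block index, translation vector, central box label -/

section ChartData

variable (ℓ k : ℕ)

/-- the number of level-`j` cube half-widths `M·L^j` per top big block `M·L^k`: `L^{k−j}`. [cite: Balaban1984PropagatorsII, p.229 («cubes □ of the size 2ML^jη»), dictionary] -/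
def rj (j : ℕ) : ℕ := (ℓ + 1) ^ (k - j)

/-- the chart index of the level-`j` torus cube with centre label `q`: the translation (in top big blocks) moving the top
big block of the centre to the block of index `2`. [cite: Balaban1984PropagatorsII, p.229, dictionary] -/
def svec (j : ℕ) (q : Fin (d + 1) → ℤ) : Fin (d + 1) → ℤ := fun μ => q μ / (rj ℓ k j : ℤ) - 2

/-- the CENTRAL BOX LABEL of the torus cube `(j, q)` in its chart: `q mod L^{k−j} + 2L^{k−j}` (a label of the top big block
of index `2`, at least two half-widths away from every wall of the fundamental box). [cite: Balaban1984PropagatorsII, p.229, dictionary] -/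
def qc (j : ℕ) (q : Fin (d + 1) → ℤ) : Fin (d + 1) → ℤ := fun μ => q μ % (rj ℓ k j : ℤ) + 2 * (rj ℓ k j : ℤ)

variable {ℓ k}

/-- `L^{k−j} ≥ 1`. [cite: Balaban1984PropagatorsII, p.229, dictionary] -/
theorem one_le_rj (j : ℕ) : 1 ≤ rj ℓ k j := Nat.one_le_pow _ _ (Nat.succ_pos ℓ)

/-- the torus label is the central label translated back: `q = qc + L^{k−j}·svec`. [cite: Balaban1984PropagatorsII, p.229, dictionary] -/
theorem q_eq_qc_add (j : ℕ) (q : Fin (d + 1) → ℤ) (μ : Fin (d + 1)) :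
    q μ = qc ℓ k j q μ + (rj ℓ k j : ℤ) * svec ℓ k j q μ := by
  simp only [qc, svec]
  have h := Int.mul_ediv_add_emod (q μ) (rj ℓ k j : ℤ)
  linarith

/-- `Pj = L^{k−j}·P`. [cite: Balaban1984PropagatorsII, p.229, dictionary] -/
theorem Pj_eq (P : Fin (d + 1) → ℕ) (j : ℕ) (μ : Fin (d + 1)) : Pj ℓ k P j μ = rj ℓ k j * P μ := rfl

/-- **THE CENTRAL LABEL IS WALL-FAR**: `2 ≤ qc_μ` and `qc_μ + 2 ≤ P_j,μ` (needs `P_μ ≥ 4`). [cite: Balaban1984PropagatorsII, p.229, dictionary] -/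
theorem qc_bounds {P : Fin (d + 1) → ℕ} (hP4 : ∀ μ, 4 ≤ P μ) (j : ℕ) (q : Fin (d + 1) → ℤ) (μ : Fin (d + 1)) :
    2 ≤ qc ℓ k j q μ ∧ qc ℓ k j q μ + 2 ≤ (Pj ℓ k P j μ : ℤ) := by
  have hr : (1 : ℤ) ≤ rj ℓ k j := by exact_mod_cast one_le_rj (ℓ := ℓ) (k := k) j
  have h0 : 0 ≤ q μ % (rj ℓ k j : ℤ) := Int.emod_nonneg _ (by omega)
  have h1 : q μ % (rj ℓ k j : ℤ) < rj ℓ k j := Int.emod_lt_of_pos _ (by omega)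
  have hP' : (4 : ℤ) * rj ℓ k j ≤ (Pj ℓ k P j μ : ℤ) := by
    rw [Pj_eq]; push_cast
    have := hP4 μ
    have : (4 : ℤ) ≤ P μ := by exact_mod_cast this
    nlinarith
  simp only [qc]
  constructor <;> nlinarith

/-- the central label is a centre label of the box presentation. [cite: Balaban1984PropagatorsII, p.229, dictionary] -/
theorem qc_mem_ctrs {P : Fin (d + 1) → ℕ} (hP4 : ∀ μ, 4 ≤ P μ) (j : ℕ) (q : Fin (d + 1) → ℤ) :
    qc ℓ k j q ∈ ctrs (Pj ℓ k P j) :=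
  mem_ctrs.2 fun μ => by have := qc_bounds (ℓ := ℓ) (k := k) hP4 j q μ; constructor <;> omega

/-- scale bookkeeping: `M·L^k = (L^j·(L·M_h))·L^{k−j}` for `j ≤ k`. [cite: Balaban1984PropagatorsII, p.229, dictionary] -/
theorem bigSide_k_eq {Mh j : ℕ} (hjk : j ≤ k) :
    bigSide ℓ Mh k = (ℓ + 1) ^ j * ((ℓ + 1) * Mh) * rj ℓ k j := by
  obtain ⟨s, rfl⟩ := Nat.exists_eq_add_of_le hjk
  simp only [bigSide, rj, Nat.add_sub_cancel_left, pow_add, pow_succ]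
  ring

/-- scale bookkeeping: `N₀ = (L^j·(L·M_h))·P_j` for `j ≤ k`. [cite: Balaban1984PropagatorsII, p.229, dictionary] -/
theorem N0_eq_mul_Pj {Mh : ℕ} {P : Fin (d + 1) → ℕ} {j : ℕ} (hjk : j ≤ k) (μ : Fin (d + 1)) :
    N0 ℓ Mh k P μ = (ℓ + 1) ^ j * ((ℓ + 1) * Mh) * Pj ℓ k P j μ := by
  rw [N0_eq_bigSide_mul, bigSide_k_eq hjk, Pj_eq]; ring

end ChartData

/-! ## §2 The central cube of a chart lies off the walls -/

section InteriorCube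

variable {ℓ Mh k : ℕ} {P : Fin (d + 1) → ℕ}

/-- **THE PROFILE OF A CENTRAL CUBE VANISHES ON THE WALLS**: `h_{qc}(w) ≠ 0 ⇒ w` is an interior site of the fundamental box
(the support `|w + ½ − N_j qc| < ⅝N_j` with `2 ≤ qc ≤ P_j − 2`). [cite: Balaban1984PropagatorsII, (2.36) p.229; Balaban1984PropagatorsI, (1.118) p.36] -/
theorem interior_of_uFun_ne_zero (hMh : 1 ≤ Mh) (hP4 : ∀ μ, 4 ≤ P μ) {j : ℕ} (hjk : j ≤ k) (q : Fin (d + 1) → ℤ)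
    (w : ↥(boxDom (N0 ℓ Mh k P))) (hw : uFun ℓ Mh j (qc ℓ k j q) w.1 ≠ 0) : Interior (N0 ℓ Mh k P) w := by
  intro μ
  have hN1 : 1 ≤ (ℓ + 1) ^ j * ((ℓ + 1) * Mh) := Nat.one_le_iff_ne_zero.2 (by positivity)
  have hNr : (1 : ℝ) ≤ (((ℓ + 1) ^ j * ((ℓ + 1) * Mh) : ℕ) : ℝ) := by exact_mod_cast hN1
  have h := abs_lt_of_hq_ne_zero hN1 (by exact hw) μ
  obtain ⟨hq2, hqP⟩ := qc_bounds (ℓ := ℓ) (k := k) hP4 j q μ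
  set Nj : ℝ := (((ℓ + 1) ^ j * ((ℓ + 1) * Mh) : ℕ) : ℝ) with hNj
  have hq2r : (2 : ℝ) ≤ (qc ℓ k j q μ : ℝ) := by exact_mod_cast hq2
  have hqPr : (qc ℓ k j q μ : ℝ) + 2 ≤ (Pj ℓ k P j μ : ℝ) := by exact_mod_cast hqP
  have hN0 : (N0 ℓ Mh k P μ : ℝ) = Nj * (Pj ℓ k P j μ : ℝ) := by
    rw [N0_eq_mul_Pj hjk μ]; push_cast; rw [hNj]; push_cast; ring
  rw [abs_lt] at h
  simp only [pos] at h
  obtain ⟨h1, h2⟩ := h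
  have hw0 := (mem_boxDom.1 w.2) μ
  have hlo : Nj * 2 ≤ Nj * (qc ℓ k j q μ : ℝ) := mul_le_mul_of_nonneg_left hq2r (by linarith)
  have hhi : Nj * ((qc ℓ k j q μ : ℝ) + 2) ≤ Nj * (Pj ℓ k P j μ : ℝ) := mul_le_mul_of_nonneg_left hqPr (by linarith)
  constructor
  · have : (7 / 8 : ℝ) < ((w.1 μ : ℤ) : ℝ) := by nlinarith
    have : (0 : ℤ) < w.1 μ := by exact_mod_cast (show (0 : ℝ) < ((w.1 μ : ℤ) : ℝ) by linarith)
    omega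
  · have : ((w.1 μ : ℤ) : ℝ) + 1 < (N0 ℓ Mh k P μ : ℝ) := by rw [hN0]; nlinarith
    have : w.1 μ + 1 < (N0 ℓ Mh k P μ : ℤ) := by exact_mod_cast this
    omega

end InteriorCube

/-! ## §3 The cover 𝒟 of the torus, one chart per cube, and the transported cube terms -/

section Cover

variable {ℓ Mh k R : ℕ} {P : Fin (d + 1) → ℕ} (D : TDomains d ℓ Mh k P R) (a c : ℕ → ℝ)

/-- the chart equivalence of the torus cube `(j, q)`: the torus translation by `(M·L^k)·svec`. [cite: Balaban1984PropagatorsII, p.229, dictionary] -/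
def σc (ℓ Mh k : ℕ) (P : Fin (d + 1) → ℕ) (j : ℕ) (q : Fin (d + 1) → ℤ) :
    ↥(boxDom (N0 ℓ Mh k P)) ≃ ↥(boxDom (N0 ℓ Mh k P)) :=
  tshift (N0 ℓ Mh k P) (TDomains.tvec ℓ Mh k (svec ℓ k j q))

/-- the box family of the chart of the torus cube `(j, q)`. [cite: Balaban1984PropagatorsII, (2.1)–(2.2) p.224, dictionary] -/
def Dc (j : ℕ) (q : Fin (d + 1) → ℤ) : Domains d ℓ Mh k P R := (D.chart (svec ℓ k j q)).toDomains

/-- the level function of the chart at a chart point is the torus level at the corresponding torus point.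
[cite: Balaban1984PropagatorsII, (2.3)–(2.4) p.224, dictionary] -/
theorem Dc_lev_symm (j : ℕ) (q : Fin (d + 1) → ℤ) (z : ↥(boxDom (N0 ℓ Mh k P))) :
    (Dc D j q).lev ((σc ℓ Mh k P j q).symm z).1 = D.lev z.1 := by
  unfold Dc σc
  rw [TDomains.toDomains_lev, TDomains.chart_lev, Equiv.apply_symm_apply]

open Classical in
/-- **THE COVER 𝒟 OF THE TORUS** as a finite index set: pairs `(j, q)` of a level `1 ≤ j ≤ k` and a periodic centre label
`q ∈ Π_μ[0, P_j,μ)` whose cube is ACTIVE (its profile meets `B^j(Λ_j)`, read in the cube's chart).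
[cite: Balaban1984PropagatorsII, p.229 («a family 𝒟 of cubes □ of different sizes and such that T_η = ⋃_{□∈𝒟} □»)] -/
def cubeSetT : Finset (ℕ × (Fin (d + 1) → ℤ)) :=
  ((Finset.Icc 1 k) ×ˢ boxDom (Pj ℓ k P 1)).filter fun cq =>
    cq.2 ∈ boxDom (Pj ℓ k P cq.1) ∧ Active (Dc D cq.1 cq.2) cq.1 (qc ℓ k cq.1 cq.2)

variable {D}

/-- the periodic label sets shrink with the level: `Π[0, P_j) ⊆ Π[0, P_1)` for `j ≥ 1`. [cite: Balaban1984PropagatorsII, p.229, dictionary] -/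
theorem boxDom_Pj_subset {j : ℕ} (hj : 1 ≤ j) : boxDom (Pj ℓ k P j) ⊆ boxDom (Pj ℓ k P 1) := by
  intro q hq
  rw [mem_boxDom] at hq ⊢
  intro μ
  obtain ⟨h0, h1⟩ := hq μ
  refine ⟨h0, lt_of_lt_of_le h1 ?_⟩
  unfold Pj
  exact_mod_cast Nat.mul_le_mul_right _ (Nat.pow_le_pow_right (by omega) (by omega))

/-- membership in the torus cover. [cite: Balaban1984PropagatorsII, p.229] -/
theorem mem_cubeSetT {cq : ℕ × (Fin (d + 1) → ℤ)} :
    cq ∈ cubeSetT D ↔ (1 ≤ cq.1 ∧ cq.1 ≤ k) ∧ cq.2 ∈ boxDom (Pj ℓ k P cq.1) ∧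
      Active (Dc D cq.1 cq.2) cq.1 (qc ℓ k cq.1 cq.2) := by
  classical
  unfold cubeSetT
  rw [Finset.mem_filter, Finset.mem_product, Finset.mem_Icc]
  constructor
  · rintro ⟨⟨hj, -⟩, hq, ha⟩; exact ⟨hj, hq, ha⟩
  · rintro ⟨hj, hq, ha⟩; exact ⟨⟨hj, boxDom_Pj_subset hj.1 hq⟩, hq, ha⟩

variable (D)

/-- data of an active torus cube: level in `[1, k]`, periodic label, activity in its chart. [cite: Balaban1984PropagatorsII, p.229–230] -/
structure CubeDataT (cq : ℕ × (Fin (d + 1) → ℤ)) : Prop where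
  hj : 1 ≤ cq.1 ∧ cq.1 ≤ k
  hq : cq.2 ∈ boxDom (Pj ℓ k P cq.1)
  hact : Active (Dc D cq.1 cq.2) cq.1 (qc ℓ k cq.1 cq.2)

variable {D}

/-- members of the torus cover carry `CubeDataT`. [cite: Balaban1984PropagatorsII, p.229] -/
theorem cubeDataT_of_mem {cq : ℕ × (Fin (d + 1) → ℤ)} (h : cq ∈ cubeSetT D) : CubeDataT D cq :=
  let ⟨hj, hq, hact⟩ := mem_cubeSetT.1 h
  ⟨hj, hq, hact⟩

/-- **A TORUS CUBE IS A CENTRAL BOX CUBE OF ITS CHART**: the box-lineage cube data of the label `qc` in the chart family.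
[cite: Balaban1984PropagatorsII, p.229–230, dictionary] -/
theorem cubeData_chart (hP4 : ∀ μ, 4 ≤ P μ) {cq : ℕ × (Fin (d + 1) → ℤ)} (hc : CubeDataT D cq) :
    CubeData (Dc D cq.1 cq.2) (cq.1, qc ℓ k cq.1 cq.2) :=
  ⟨hc.hj, qc_mem_ctrs hP4 _ _, hc.hact⟩

variable (D)

/-- the LEFT cut-off `u_□ = h_□` of a torus cube, transported from its chart. [cite: Balaban1984PropagatorsII, (2.36)–(2.37) p.229] -/
def uT (cq : ℕ × (Fin (d + 1) → ℤ)) (z : ↥(boxDom (N0 ℓ Mh k P))) : ℝ :=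
  uX (cq.1, qc ℓ k cq.1 cq.2) ((σc ℓ Mh k P cq.1 cq.2).symm z)

/-- the RIGHT cut-off `v_□ = h_□·1_{B^j(Λ_j)}` of a torus cube, transported from its chart. [cite: Balaban1984PropagatorsII, (2.36)–(2.37) p.229] -/
def vT (cq : ℕ × (Fin (d + 1) → ℤ)) (z : ↥(boxDom (N0 ℓ Mh k P))) : ℝ :=
  vX (Dc D cq.1 cq.2) (cq.1, qc ℓ k cq.1 cq.2) ((σc ℓ Mh k P cq.1 cq.2).symm z)

/-- `v_□ = u_□·1_{lev = j}` on the torus. [cite: Balaban1984PropagatorsII, (2.36)–(2.37) p.229] -/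
theorem vT_eq (cq : ℕ × (Fin (d + 1) → ℤ)) (z : ↥(boxDom (N0 ℓ Mh k P))) :
    vT D cq z = uT cq z * (if D.lev z.1 = cq.1 then 1 else 0) := by
  unfold vT uT vX vFun uX
  rw [Dc_lev_symm]

/-- **THE SUMMAND `h_□G′(□)v_□` OF (2.37) ON THE TORUS**: the box term of the central cube of the chart, transported along
the chart translation. [cite: Balaban1984PropagatorsII, (2.37) p.229] -/
def aT (hP : ∀ μ, 1 ≤ P μ) (hP4 : ∀ μ, 4 ≤ P μ) (cq : ℕ × (Fin (d + 1) → ℤ)) (hc : CubeDataT D cq) :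
    Matrix ↥(boxDom (N0 ℓ Mh k P)) ↥(boxDom (N0 ℓ Mh k P)) ℝ :=
  Matrix.reindex (σc ℓ Mh k P cq.1 cq.2) (σc ℓ Mh k P cq.1 cq.2)
    (aX (Dc D cq.1 cq.2) a c hP (cq.1, qc ℓ k cq.1 cq.2) (cubeData_chart hP4 hc))

/-- **THE SUMMAND `K(h_□)G′(□)v_□` OF `R` (2.38) ON THE TORUS**, transported from the chart. [cite: Balaban1984PropagatorsII, (2.38) p.229, (2.44) p.230] -/
def bT (hP : ∀ μ, 1 ≤ P μ) (hP4 : ∀ μ, 4 ≤ P μ) (cq : ℕ × (Fin (d + 1) → ℤ)) (hc : CubeDataT D cq) :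
    Matrix ↥(boxDom (N0 ℓ Mh k P)) ↥(boxDom (N0 ℓ Mh k P)) ℝ :=
  Matrix.reindex (σc ℓ Mh k P cq.1 cq.2) (σc ℓ Mh k P cq.1 cq.2)
    (bX (Dc D cq.1 cq.2) a c hP (cq.1, qc ℓ k cq.1 cq.2) (cubeData_chart hP4 hc))

/-- **`G′₀ = Σ_{□∈𝒟} h_□G′(□)v_□` (2.37) ON THE TORUS**. [cite: Balaban1984PropagatorsII, (2.37) p.229] -/
def gZeroT (hP : ∀ μ, 1 ≤ P μ) (hP4 : ∀ μ, 4 ≤ P μ) : Matrix ↥(boxDom (N0 ℓ Mh k P)) ↥(boxDom (N0 ℓ Mh k P)) ℝ :=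
  ∑ cq ∈ (cubeSetT D).attach, aT D a c hP hP4 cq.1 (cubeDataT_of_mem cq.2)

/-- **`R = Σ_{□∈𝒟} K(h_□)G′(□)v_□` (2.38) ON THE TORUS**. [cite: Balaban1984PropagatorsII, (2.38) p.229] -/
def rT (hP : ∀ μ, 1 ≤ P μ) (hP4 : ∀ μ, 4 ≤ P μ) : Matrix ↥(boxDom (N0 ℓ Mh k P)) ↥(boxDom (N0 ℓ Mh k P)) ℝ :=
  ∑ cq ∈ (cubeSetT D).attach, bT D a c hP hP4 cq.1 (cubeDataT_of_mem cq.2)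

variable {D a c}

/-- the wall rows of a central box term vanish (its left cut-off does). [cite: Balaban1984PropagatorsII, (2.37) p.229, dictionary] -/
theorem aX_wall_row (hMh : 1 ≤ Mh) (hP : ∀ μ, 1 ≤ P μ) (hP4 : ∀ μ, 4 ≤ P μ) {cq : ℕ × (Fin (d + 1) → ℤ)}
    (hc : CubeDataT D cq) (w : ↥(boxDom (N0 ℓ Mh k P))) (hw : ¬ Interior (N0 ℓ Mh k P) w)
    (y : ↥(boxDom (N0 ℓ Mh k P))) :
    aX (Dc D cq.1 cq.2) a c hP (cq.1, qc ℓ k cq.1 cq.2) (cubeData_chart hP4 hc) w y = 0 := by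
  have hu : uX (ℓ := ℓ) (Mh := Mh) (k := k) (P := P) (cq.1, qc ℓ k cq.1 cq.2) w = 0 := by
    by_contra h
    exact hw (interior_of_uFun_ne_zero hMh hP4 hc.hj.2 cq.2 w h)
  unfold aX
  rw [Matrix.mul_assoc, Matrix.diagonal_mul, hu, zero_mul]

/-- **`Δ′_a` TIMES ONE SUMMAND ON THE TORUS**: `Δ′_a·(h_□G′(□)v_□) = h_□v_□ − K(h_□)G′(□)v_□` — the box identity
`mlOp_mul_aX` of the chart, transported by the chart identity of `B6MultiLevelTorusOperator` (the seam does not see a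
central cube). [cite: Balaban1984PropagatorsII, (2.37)–(2.38) p.229] -/
theorem mlOpT_mul_aT (hℓ : 1 ≤ ℓ) (hR : 2 * (ℓ + 1) ≤ R) (hP : ∀ μ, 1 ≤ P μ) (hP4 : ∀ μ, 4 ≤ P μ) (hMh : 1 ≤ Mh)
    (ha : ∀ i, 1 ≤ i → 0 < a i) (hcpos : ∀ i, 1 ≤ i → 0 < c i)
    (hac : ∀ i, 1 ≤ i → a (i + 1) = aNext ℓ (a i) (c i))
    (cq : ℕ × (Fin (d + 1) → ℤ)) (hc : CubeDataT D cq) :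
    mlOpT (N0 ℓ Mh k P) ℓ k D.lev a * aT D a c hP hP4 cq hc
      = Matrix.diagonal (fun z => uT cq z * vT D cq z) - bT D a c hP hP4 cq hc := by
  unfold aT bT σc
  rw [mlOpT_mul_reindex D hMh hP a (svec ℓ k cq.1 cq.2) (fun w hw y => aX_wall_row hMh hP hP4 hc w hw y)]
  have h := mlOp_mul_aX (D := Dc D cq.1 cq.2) (a := a) (c := c) hℓ hR hP hMh ha hcpos hac
    (cq.1, qc ℓ k cq.1 cq.2) (cubeData_chart hP4 hc)
  unfold Dc at h ⊢
  rw [h]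
  simp only [Matrix.reindex_apply, Matrix.submatrix_sub, Pi.sub_apply, Matrix.submatrix_diagonal_equiv]
  rfl

end Cover

/-! ## §4 (2.36) on the torus: the transported profiles are the PERIODIC (1.118) partition of unity -/

section Partition

variable {ℓ Mh k R : ℕ} {P : Fin (d + 1) → ℕ}

/-- the number of whole periods separating a torus site from the chart of the cube `(j, q)`:
`⌊(z − (M·L^k)·svec)/N₀⌋` coordinatewise. [cite: Balaban1984PropagatorsII, (2.36) p.229, dictionary] -/
def mz (ℓ Mh k : ℕ) (P : Fin (d + 1) → ℕ) (j : ℕ) (q z : Fin (d + 1) → ℤ) : Fin (d + 1) → ℤ :=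
  fun μ => (z μ - TDomains.tvec ℓ Mh k (svec ℓ k j q) μ) / (N0 ℓ Mh k P μ : ℤ)

/-- the chart coordinates of a torus site: `σ⁻¹z = z − (M·L^k)·svec − N₀·mz`. [cite: Balaban1984PropagatorsII, (2.36) p.229, dictionary] -/
theorem σc_symm_val (j : ℕ) (q : Fin (d + 1) → ℤ) (z : ↥(boxDom (N0 ℓ Mh k P))) :
    ((σc ℓ Mh k P j q).symm z).1
      = fun μ => z.1 μ - TDomains.tvec ℓ Mh k (svec ℓ k j q) μ - (N0 ℓ Mh k P μ : ℤ) * mz ℓ Mh k P j q z.1 μ := by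
  unfold σc
  rw [tshift_symm_apply, tshift_val, twrap_eq_translate]
  funext μ
  simp only [translate_apply, Pi.add_apply, Pi.neg_apply, mz, sub_eq_add_neg]
  ring

/-- the relabelling map of the periodic partition at the site `z`: `q ↦ q + P_j·mz`. [cite: Balaban1984PropagatorsII, (2.36) p.229, dictionary] -/
def Qmap (ℓ Mh k : ℕ) (P : Fin (d + 1) → ℕ) (j : ℕ) (z q : Fin (d + 1) → ℤ) : Fin (d + 1) → ℤ :=
  q + fun μ => (Pj ℓ k P j μ : ℤ) * mz ℓ Mh k P j q z μ

/-- **THE TRANSPORTED PROFILE IS A PERIODIC TRANSLATE OF THE PRINTED PROFILE**: `u_□(z) = h_{q + P_j·mz}(z)` for the torus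
cube `□ = (j, q)` (the (1.118) profile of the lattice label `q + P_j·mz(z)`, read at the representative `z ∈ Π[0, N₀)`).
[cite: Balaban1984PropagatorsII, (2.36) p.229; Balaban1984PropagatorsI, (1.118) p.36] -/
theorem uT_eq (hMh : 1 ≤ Mh) {cq : ℕ × (Fin (d + 1) → ℤ)} (hjk : cq.1 ≤ k) (z : ↥(boxDom (N0 ℓ Mh k P))) :
    uT cq z = hq ((ℓ + 1) ^ cq.1) ((ℓ + 1) * Mh) (Qmap ℓ Mh k P cq.1 z.1 cq.2) z.1 := by
  have hN1 : 1 ≤ (ℓ + 1) ^ cq.1 * ((ℓ + 1) * Mh) := Nat.one_le_iff_ne_zero.2 (by positivity)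
  unfold uT uX uFun
  dsimp only
  rw [σc_symm_val]
  set s : Fin (d + 1) → ℤ := fun μ => -((rj ℓ k cq.1 : ℤ) * svec ℓ k cq.1 cq.2 μ)
    - (Pj ℓ k P cq.1 μ : ℤ) * mz ℓ Mh k P cq.1 cq.2 z.1 μ with hs
  have e : (fun μ => z.1 μ - TDomains.tvec ℓ Mh k (svec ℓ k cq.1 cq.2) μ
      - (N0 ℓ Mh k P μ : ℤ) * mz ℓ Mh k P cq.1 cq.2 z.1 μ)
      = z.1 + fun μ => (((ℓ + 1) ^ cq.1 * ((ℓ + 1) * Mh) : ℕ) : ℤ) * s μ := by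
    funext μ
    simp only [Pi.add_apply, hs, TDomains.tvec, bigSide_k_eq hjk, N0_eq_mul_Pj hjk μ]
    push_cast
    ring
  rw [e, hq_add_mul _ _ hN1]
  congr 1
  funext μ
  simp only [Qmap, Pi.sub_apply, Pi.add_apply, hs, q_eq_qc_add (ℓ := ℓ) (k := k) cq.1 cq.2 μ]
  ring

/-- **UNIQUENESS OF THE PERIOD**: if the printed profile of the lattice label `q + P_j·m` sees the site `z ∈ Π[0, N₀)`,
then `m = mz(z)` — because the central cube of the chart lies inside one period. [cite: Balaban1984PropagatorsII, (2.36) p.229, dictionary] -/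
theorem mz_unique (hMh : 1 ≤ Mh) (hP4 : ∀ μ, 4 ≤ P μ) {j : ℕ} (hjk : j ≤ k) (q m : Fin (d + 1) → ℤ)
    (z : ↥(boxDom (N0 ℓ Mh k P)))
    (h : hq ((ℓ + 1) ^ j) ((ℓ + 1) * Mh) (q + fun μ => (Pj ℓ k P j μ : ℤ) * m μ) z.1 ≠ 0) :
    m = mz ℓ Mh k P j q z.1 := by
  have hN1 : 1 ≤ (ℓ + 1) ^ j * ((ℓ + 1) * Mh) := Nat.one_le_iff_ne_zero.2 (by positivity)
  funext μ
  have hb := abs_lt_of_hq_ne_zero hN1 h μ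
  obtain ⟨hq2, hqP⟩ := qc_bounds (ℓ := ℓ) (k := k) hP4 j q μ
  set Nj : ℝ := (((ℓ + 1) ^ j * ((ℓ + 1) * Mh) : ℕ) : ℝ) with hNj
  have hNr : (1 : ℝ) ≤ Nj := by rw [hNj]; exact_mod_cast hN1
  have hq2r : (2 : ℝ) ≤ (qc ℓ k j q μ : ℝ) := by exact_mod_cast hq2
  have hqPr : (qc ℓ k j q μ : ℝ) + 2 ≤ (Pj ℓ k P j μ : ℝ) := by exact_mod_cast hqP
  have hlo : Nj * 2 ≤ Nj * (qc ℓ k j q μ : ℝ) := mul_le_mul_of_nonneg_left hq2r (by linarith)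
  have hhi : Nj * ((qc ℓ k j q μ : ℝ) + 2) ≤ Nj * (Pj ℓ k P j μ : ℝ) := mul_le_mul_of_nonneg_left hqPr (by linarith)
  -- the chart coordinate `w = z − t − N₀m`
  set w : ℤ := z.1 μ - TDomains.tvec ℓ Mh k (svec ℓ k j q) μ - (N0 ℓ Mh k P μ : ℤ) * m μ with hw
  have hwr : (w : ℝ) = ((z.1 μ : ℤ) : ℝ) - Nj * ((q μ : ℝ) + (Pj ℓ k P j μ : ℝ) * (m μ : ℝ)) + Nj * (qc ℓ k j q μ : ℝ) := by
    have ht : (TDomains.tvec ℓ Mh k (svec ℓ k j q) μ : ℝ) = Nj * ((q μ : ℝ) - (qc ℓ k j q μ : ℝ)) := by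
      simp only [TDomains.tvec, bigSide_k_eq hjk]
      have := q_eq_qc_add (ℓ := ℓ) (k := k) j q μ
      have hq' : (q μ : ℝ) = (qc ℓ k j q μ : ℝ) + (rj ℓ k j : ℝ) * (svec ℓ k j q μ : ℝ) := by exact_mod_cast this
      rw [hNj, hq']; push_cast; ring
    rw [hw, N0_eq_mul_Pj hjk μ]; push_cast; rw [ht, hNj]; push_cast; ring
  rw [abs_lt] at hb
  simp only [pos, Pi.add_apply] at hb
  push_cast at hb
  obtain ⟨hb1, hb2⟩ := hb
  have hw0 : 0 ≤ w := by
    have : (0 : ℝ) < (w : ℝ) := by rw [hwr]; nlinarith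
    exact_mod_cast this.le
  have hw1 : w < (N0 ℓ Mh k P μ : ℤ) := by
    have hN0 : ((N0 ℓ Mh k P μ : ℤ) : ℝ) = Nj * (Pj ℓ k P j μ : ℝ) := by
      rw [N0_eq_mul_Pj hjk μ, hNj]; push_cast; ring
    have : (w : ℝ) < ((N0 ℓ Mh k P μ : ℤ) : ℝ) := by rw [hwr, hN0]; nlinarith
    exact_mod_cast this
  have hN0pos : (0 : ℤ) < (N0 ℓ Mh k P μ : ℤ) := lt_of_le_of_lt hw0 hw1
  -- `(z − t)/N₀ = m`
  simp only [mz]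
  have e : z.1 μ - TDomains.tvec ℓ Mh k (svec ℓ k j q) μ = w + (N0 ℓ Mh k P μ : ℤ) * m μ := by rw [hw]; ring
  rw [e, Int.add_mul_ediv_left _ _ hN0pos.ne', Int.ediv_eq_zero_of_lt hw0 hw1, zero_add]

/-- the relabelling map is injective on the periodic labels `Π[0, P_j)` (a label is recovered modulo `P_j`).
[cite: Balaban1984PropagatorsII, (2.36) p.229, dictionary] -/
theorem Qmap_injOn (j : ℕ) (z : Fin (d + 1) → ℤ) :
    Set.InjOn (Qmap ℓ Mh k P j z) ↑(boxDom (Pj ℓ k P j)) := by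
  intro q hq q' hq' h
  funext μ
  have e : ∀ r ∈ boxDom (Pj ℓ k P j), r μ = Qmap ℓ Mh k P j z r μ % (Pj ℓ k P j μ : ℤ) := by
    intro r hr
    obtain ⟨h0, h1⟩ := (mem_boxDom.1 hr) μ
    simp only [Qmap, Pi.add_apply]
    rw [Int.add_mul_emod_self_left, Int.emod_eq_of_lt h0 h1]
  rw [e q hq, e q' hq', h]

/-- every printed profile seeing `z` is a relabelled periodic label. [cite: Balaban1984PropagatorsII, (2.36) p.229; Balaban1984PropagatorsI, (1.118) p.36] -/
theorem mem_image_Qmap (hMh : 1 ≤ Mh) (hP : ∀ μ, 1 ≤ P μ) (hP4 : ∀ μ, 4 ≤ P μ) {j : ℕ} (hjk : j ≤ k)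
    (z : ↥(boxDom (N0 ℓ Mh k P))) {q' : Fin (d + 1) → ℤ}
    (h : hq ((ℓ + 1) ^ j) ((ℓ + 1) * Mh) q' z.1 ≠ 0) :
    q' ∈ (boxDom (Pj ℓ k P j)).image (Qmap ℓ Mh k P j z.1) := by
  have hPj : ∀ μ, 1 ≤ Pj ℓ k P j μ := one_le_Pj hP j
  set q := twrap (Pj ℓ k P j) q' with hqdef
  have hqmem : q ∈ boxDom (Pj ℓ k P j) := twrap_mem hPj q'
  set m : Fin (d + 1) → ℤ := fun μ => q' μ / (Pj ℓ k P j μ : ℤ) with hm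
  have hdec : q' = q + fun μ => (Pj ℓ k P j μ : ℤ) * m μ := by
    funext μ
    simp only [hqdef, twrap, Pi.add_apply, hm]
    linarith [Int.mul_ediv_add_emod (q' μ) (Pj ℓ k P j μ : ℤ)]
  rw [hdec] at h
  have hmz := mz_unique hMh hP4 hjk q m z h
  refine Finset.mem_image.2 ⟨q, hqmem, ?_⟩
  rw [hdec, hmz]
  rfl

/-- **(2.36) ON THE TORUS, ONE LEVEL**: `Σ_{q ∈ Π[0,P_j)} u_{(j,q)}(z)² = 1` at every torus site — the periodic (1.118)
partition of unity, as the relabelled lattice identity `Σ_{q∈ℤ^{d+1}} h_q² = 1`. [cite: Balaban1984PropagatorsII, (2.36) p.229; Balaban1984PropagatorsI, (1.118) p.36] -/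
theorem sum_uT_sq (hMh : 1 ≤ Mh) (hP : ∀ μ, 1 ≤ P μ) (hP4 : ∀ μ, 4 ≤ P μ) {j : ℕ} (hjk : j ≤ k)
    (z : ↥(boxDom (N0 ℓ Mh k P))) : ∑ q ∈ boxDom (Pj ℓ k P j), uT (ℓ := ℓ) (Mh := Mh) (j, q) z ^ 2 = 1 := by
  have hterm : ∀ q ∈ boxDom (Pj ℓ k P j), uT (ℓ := ℓ) (Mh := Mh) (k := k) (P := P) (j, q) z ^ 2
      = hq ((ℓ + 1) ^ j) ((ℓ + 1) * Mh) (Qmap ℓ Mh k P j z.1 q) z.1 ^ 2 := fun q _ => by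
    rw [uT_eq hMh (cq := (j, q)) hjk z]
  rw [Finset.sum_congr rfl hterm, ← Finset.sum_image (f := fun q' => hq ((ℓ + 1) ^ j) ((ℓ + 1) * Mh) q' z.1 ^ 2)
    (Qmap_injOn j z.1)]
  exact sum_hCube_sq _ _ _ fun q' hq' => mem_image_Qmap hMh hP hP4 hjk z hq'

variable {D : TDomains d ℓ Mh k P R}

/-- a cube whose profile sees a site of its own level is active (the site, read in the chart, is the witness).
[cite: Balaban1984PropagatorsII, p.229 («center y ∈ Λ_j (… boundary … also)»)] -/
theorem active_of_uT_ne_zero {j : ℕ} {q : Fin (d + 1) → ℤ} {z : ↥(boxDom (N0 ℓ Mh k P))} (hlev : D.lev z.1 = j)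
    (h : uT (ℓ := ℓ) (Mh := Mh) (k := k) (P := P) (j, q) z ≠ 0) : Active (Dc D j q) j (qc ℓ k j q) :=
  ⟨((σc ℓ Mh k P j q).symm z).1, ((σc ℓ Mh k P j q).symm z).2, by rw [Dc_lev_symm]; exact hlev, h⟩

/-- **(2.36) FOR THE TORUS COVER**: `Σ_{□∈𝒟} u_□(z)v_□(z) = 1` at every site of the torus — the periodic (1.118) identity of
the level of `z`, the other levels cut away by `1_{B^j(Λ_j)}`, inactive cubes vanishing at `z`.
[cite: Balaban1984PropagatorsII, (2.36) p.229; Balaban1984PropagatorsI, (1.118) p.36] -/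
theorem sum_uv_eq_one_T (hMh : 1 ≤ Mh) (hP : ∀ μ, 1 ≤ P μ) (hP4 : ∀ μ, 4 ≤ P μ)
    (z : ↥(boxDom (N0 ℓ Mh k P))) :
    ∑ cq ∈ (cubeSetT D).attach, uT cq.1 z * vT D cq.1 z = 1 := by
  classical
  rw [Finset.sum_attach (cubeSetT D) (fun cq => uT cq z * vT D cq z)]
  unfold cubeSetT
  rw [Finset.sum_filter, Finset.sum_product]
  have hj₀mem : D.lev z.1 ∈ Finset.Icc 1 k := Finset.mem_Icc.2 ⟨D.one_le_lev _, D.lev_le _⟩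
  have hrow : ∀ j ∈ Finset.Icc 1 k, ∑ q ∈ boxDom (Pj ℓ k P 1),
      (if (j, q).2 ∈ boxDom (Pj ℓ k P (j, q).1) ∧ Active (Dc D (j, q).1 (j, q).2) (j, q).1 (qc ℓ k (j, q).1 (j, q).2)
        then uT (j, q) z * vT D (j, q) z else 0)
        = if j = D.lev z.1 then 1 else 0 := by
    intro j hj
    have hjk : j ≤ k := (Finset.mem_Icc.1 hj).2
    have hj1 : 1 ≤ j := (Finset.mem_Icc.1 hj).1
    -- restrict to the labels of level `j`
    rw [← Finset.sum_subset (boxDom_Pj_subset (k := k) (P := P) hj1) (fun q _ hq => by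
      dsimp only; rw [if_neg (fun h => hq h.1)])]
    by_cases hjj : j = D.lev z.1
    · rw [if_pos hjj]
      have hterm : ∀ q ∈ boxDom (Pj ℓ k P j),
          (if (j, q).2 ∈ boxDom (Pj ℓ k P (j, q).1) ∧ Active (Dc D (j, q).1 (j, q).2) (j, q).1 (qc ℓ k (j, q).1 (j, q).2)
            then uT (j, q) z * vT D (j, q) z else 0) = uT (ℓ := ℓ) (Mh := Mh) (k := k) (P := P) (j, q) z ^ 2 := by
        intro q hq
        dsimp only
        by_cases hu : uT (ℓ := ℓ) (Mh := Mh) (k := k) (P := P) (j, q) z = 0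
        · rw [hu]; simp
        · rw [if_pos ⟨hq, active_of_uT_ne_zero hjj.symm hu⟩, vT_eq, if_pos hjj.symm]; ring
      rw [Finset.sum_congr rfl hterm]
      exact sum_uT_sq hMh hP hP4 hjk z
    · rw [if_neg hjj]
      refine Finset.sum_eq_zero fun q _ => ?_
      dsimp only
      split_ifs
      · rw [vT_eq, if_neg (fun h => hjj h.symm)]; ring
      · rfl
  rw [Finset.sum_congr rfl hrow]
  simp [hj₀mem]

end Partition

/-! ## §5 (2.38) on the torus -/

section Eq238

variable {ℓ Mh k R : ℕ} {P : Fin (d + 1) → ℕ} {D : TDomains d ℓ Mh k P R} {a c : ℕ → ℝ}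

/-- a finite sum of diagonal matrices is the diagonal matrix of the sum. [folklore] -/
private theorem sum_diagonal {X ι : Type*} [DecidableEq X] (s : Finset ι) (f : ι → X → ℝ) :
    ∑ i ∈ s, Matrix.diagonal (f i) = Matrix.diagonal (fun x => ∑ i ∈ s, f i x) := by
  classical
  induction s using Finset.induction_on with
  | empty => simp
  | insert a s ha ih =>
      rw [Finset.sum_insert ha, ih, Matrix.diagonal_add]
      congr 1
      funext x
      rw [Finset.sum_insert ha]

/-- **[B6] (2.38) FOR THE GENUINE `k`-LEVEL OPERATOR ON THE TORUS `T_η`**: `Δ′_a·G′₀ = 1 − R` with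
`G′₀ = Σ_{□∈𝒟} h_□G′(□)v_□` over the multi-size cover of the torus (every cube term the genuine two-level Neumann cube
propagator of the lineage, transported from the cube's chart) and `R = Σ_{□∈𝒟} K(h_□)G′(□)v_□` — for every nested family
(2.1)–(2.2) of domains of the torus with `R ≥ 2L`, every `k ≥ 1`, `L ≥ 2`, `M_h ≥ 1`, every torus with `P_μ ≥ 4` top blocks
per direction, and every positive weights with `a_{i+1} = aNext ℓ a_i c_i`. [cite: Balaban1984PropagatorsII, (2.36)–(2.38) p.229] -/
theorem eq238_multiLevelTorus (hℓ : 1 ≤ ℓ) (hR : 2 * (ℓ + 1) ≤ R) (hP : ∀ μ, 1 ≤ P μ) (hP4 : ∀ μ, 4 ≤ P μ)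
    (hMh : 1 ≤ Mh) (ha : ∀ i, 1 ≤ i → 0 < a i) (hcpos : ∀ i, 1 ≤ i → 0 < c i)
    (hac : ∀ i, 1 ≤ i → a (i + 1) = aNext ℓ (a i) (c i)) :
    mlOpT (N0 ℓ Mh k P) ℓ k D.lev a * gZeroT D a c hP hP4 = 1 - rT D a c hP hP4 := by
  unfold gZeroT rT
  rw [Finset.mul_sum]
  rw [Finset.sum_congr rfl fun cq _ => mlOpT_mul_aT hℓ hR hP hP4 hMh ha hcpos hac cq.1 (cubeDataT_of_mem cq.2),
    Finset.sum_sub_distrib, sum_diagonal]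
  congr 1
  have : (fun x : ↥(boxDom (N0 ℓ Mh k P)) => ∑ cq ∈ (cubeSetT D).attach,
      uT cq.1 x * vT D cq.1 x) = fun _ => 1 := funext fun z => sum_uv_eq_one_T (D := D) hMh hP hP4 z
  rw [this]
  exact Matrix.diagonal_one

end Eq238

end

end Literature.MathematicalPhysics.QuantumFieldTheory.Balaban1983to89.B6Eq238MultiLevelTorus
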